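import Literature.NumberTheory.LFunctions.RHInvZetaBound
import Literature.NumberTheory.LFunctions.GeneralizedRH
import HarnessLib

/-!
# `1/ζ(s) = O(t^ε)` on `σ > θ` under the quasi-Riemann hypothesis (`ζ ≠ 0` on `θ < Re s < 1`)

Topic: `Literature/NumberTheory/LFunctions`. The analogue, under the zero-free strip hypothesis
`Literature.QuasiRiemannHypothesis θ` (`1/2 ≤ θ < 1`), of Littlewood's theorem (J. E. Littlewood,
C. R. Acad. Sci. Paris 154 (1912), 263–266) in the form of Titchmarsh, *The Theory of the
Riemann Zeta-Function*, 2nd ed. (1986), Thm. 14.2, eq. (14.2.6): `1/ζ(s) = O(t^ε)` for every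
`σ > θ`, uniformly in `σ ≥ σ₀ > θ`. Titchmarsh prints the case `θ = 1/2` (RH); the proof
(§14.2, pp. 247–248: Borel–Carathéodory applied to `log ζ` on discs to the right of the
zero-free abscissa, then Hadamard's three-circles theorem) uses only that `log ζ` is regular on
`σ > θ` away from `s = 1`, and is verbatim for general `θ`. The RH case is `RHInvZetaBound.lean`
(`Literature.InvZetaRH.*`), whose general lemmas (three circles, holomorphic logarithms on discs, the
bounds for `ζ`, `log ζ`, `1/ζ` on `Re s ≥ 2`, and the geometry of the discs centred `3 + it`)
are reused here. This file is the analytic input of the general-`θ` Mertens bound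
`M(x) = O(x^{θ+ε})` (`QuasiRHFactsProofs.lean`, discharging the named fact
`Literature.NumberTheory.LFunctions.mertens_isBigO_of_quasiRiemannHypothesis` of `QuasiRHFacts.lean`).

The discs: centre `3 + it` (`|t| ≥ 7`), Borel–Carathéodory radius `3 − θ − δ/2` (inside
`Re s > θ + δ/2`, and inside the RH-case disc of radius `5/2 − δ/2` as `θ ≥ 1/2`), outer
circle of radius `3 − θ − δ` (through `θ + δ + it`), inner circle of radius `1/2` (through
`5/2 + it`, where `‖log ζ‖ ≤ B₁`), giving the three-circles exponent
`a₀(θ, δ) = log(6−2θ−4δ)/log(6−2θ−2δ) < 1` at the points `σ + it`, `θ + 2δ ≤ σ ≤ 5/2`.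

## Main results (all proved)

* `Literature.NumberTheory.LFunctions.InvZetaQuasiRH.riemannZeta_ne_zero_of_quasiRH` — under quasi-RH(`θ`), `ζ(s) ≠ 0` for
  `Re s > θ` (`ζ ≠ 0` on `Re s ≥ 1` is Mathlib's `riemannZeta_ne_zero_of_one_le_re`).
* `Literature.NumberTheory.LFunctions.InvZetaQuasiRH.exists_log_riemannZeta` — the analogue of Titchmarsh (14.2.2): a branch
  `L` of `log ζ` on `‖z − (3+it)‖ < 3 − θ − δ/2` with `‖L‖ ≤ A₃ δ⁻¹ log|t|` on the closed disc
  of radius `3 − θ − δ`.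
* `Literature.NumberTheory.LFunctions.InvZetaQuasiRH.norm_log_le_rpow` — the three-circles step:
  `‖L(σ+it)‖ ≤ B₂ (A₃δ⁻¹ log|t|)^{a₀(θ,δ)}` for `θ + 2δ ≤ σ ≤ 5/2`.
* `Literature.NumberTheory.LFunctions.InvZetaQuasiRH.norm_inv_riemannZeta_le_rpow` — the analogue of (14.2.6): under
  quasi-RH(`θ`), `1/2 ≤ θ < 1`, for `σ₀ > θ` and `ε > 0` there is `T` with
  `‖ζ(σ+it)⁻¹‖ ≤ |t|^ε` for all `σ ≥ σ₀`, `|t| ≥ T`.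

## References

* E. C. Titchmarsh, *The Theory of the Riemann Zeta-Function*, 2nd ed. revised by
  D. R. Heath-Brown, Oxford 1986, §14.2: Thm. 14.2 and eqs. (14.2.2), (14.2.6) (pp. 247–248).
* J. E. Littlewood, *Quelques conséquences de l'hypothèse que la fonction ζ(s) n'a pas de zéros
  dans le demi-plan Re(s) > 1/2*, C. R. Acad. Sci. Paris 154 (1912), 263–266.

## Design choices

* Same centre `3 + it` and constants `A₃`, `B₁`, `B₂` as the RH case, so that the disc lemmas
  of `RHInvZetaBound.lean` apply by inclusion of balls; only the radii depend on `θ`, and they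
  are written out (`3 − θ − δ/2`, `3 − θ − δ`) rather than named.
* `1/2 ≤ θ` is assumed where the RH-case disc lemmas are invoked (it is a hypothesis of the
  target named fact); `θ < 1` is needed only for the radii to be admissible.
-/

noncomputable section

open Complex Filter Topology Metric Set
open scoped Real

namespace Literature.NumberTheory.LFunctions

namespace InvZetaQuasiRH

open InvZetaRH

/-! ### `ζ` under quasi-RH on `Re s > θ` -/

/-- Under `QuasiRiemannHypothesis θ`, `ζ(s) ≠ 0` for `Re s > θ`: in the strip `Re s < 1` this
is the hypothesis, and on `Re s ≥ 1` it is Mathlib's `riemannZeta_ne_zero_of_one_le_re` (the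
value `ζ(1)` of Mathlib is a non-zero junk value). [folklore] -/
lemma riemannZeta_ne_zero_of_quasiRH {θ : ℝ} (hQ : QuasiRiemannHypothesis θ) {s : ℂ}
    (hs : θ < s.re) : riemannZeta s ≠ 0 := by
  intro h0
  by_cases h1 : s.re < 1
  · exact hQ s h0 hs h1
  · exact riemannZeta_ne_zero_of_one_le_re (not_lt.mp h1) h0

/-! ### The discs (centre `3 + it`, radii `3 − θ − δ/2` and `3 − θ − δ`) -/

variable {θ δ t : ℝ}

/-- The disc of radius `3 − θ − δ/2` is inside the RH-case disc of radius `5/2 − δ/2`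
(`θ ≥ 1/2`). [folklore] -/
lemma ball_subset_ball_RH (hθ : 1 / 2 ≤ θ) :
    ball (ctr t) (3 - θ - δ / 2) ⊆ ball (ctr t) (InvZetaRH.R₀ δ) :=
  ball_subset_ball (by unfold InvZetaRH.R₀; linarith)

/-- Points of the disc `‖z − (3+it)‖ < 3 − θ − δ/2` have `Re z > θ + δ/2`. [folklore] -/
lemma re_gt_of_mem_ball {z : ℂ} (hz : z ∈ ball (ctr t) (3 - θ - δ / 2)) :
    θ + δ / 2 < z.re := by
  rw [mem_ball, dist_eq_norm] at hz
  have h := abs_re_le_norm (z - ctr t)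
  simp only [sub_re, ctr_re] at h
  have := neg_abs_le (z.re - 3)
  linarith

/-- `ζ` is zero-free on the disc `‖z − (3+it)‖ < 3 − θ − δ/2` under quasi-RH(`θ`) (`δ > 0`).
[folklore] -/
lemma riemannZeta_ne_zero_of_mem_ball (hQ : QuasiRiemannHypothesis θ) (hδ : 0 < δ) {z : ℂ}
    (hz : z ∈ ball (ctr t) (3 - θ - δ / 2)) : riemannZeta z ≠ 0 :=
  riemannZeta_ne_zero_of_quasiRH hQ (by linarith [re_gt_of_mem_ball hz])

/-! ### The Borel–Carathéodory step: the analogue of Titchmarsh (14.2.2) -/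

/-- **Analogue of Titchmarsh (14.2.2) under quasi-RH(`θ`).** For `1/2 ≤ θ < 1`,
`0 < δ ≤ 1/2` and `|t| ≥ 7` there is a holomorphic branch `L` of `log ζ` on the disc
`‖z − (3+it)‖ < 3 − θ − δ/2` (so on `Re z > θ + δ/2`), equal to the principal `log ζ(z)` for
`Re z > 2`, with `‖L(z)‖ ≤ A₃ δ⁻¹ log|t|` on the closed disc of radius `3 − θ − δ`:
Borel–Carathéodory (Mathlib `Complex.borelCaratheodory`) with `Re L = log|ζ| ≤ 2 log|t|`.
Titchmarsh prints `θ = 1/2`; the argument is verbatim.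
[cite: Titchmarsh1986, Thm 14.2, eq. (14.2.2)] -/
theorem exists_log_riemannZeta (hQ : QuasiRiemannHypothesis θ) (hθ : 1 / 2 ≤ θ) (hθ1 : θ < 1)
    (hδ : 0 < δ) (hδ2 : δ ≤ 1 / 2) (ht : 7 ≤ |t|) :
    ∃ L : ℂ → ℂ, DifferentiableOn ℂ L (ball (ctr t) (3 - θ - δ / 2)) ∧
      (∀ z ∈ ball (ctr t) (3 - θ - δ / 2), exp (L z) = riemannZeta z) ∧
      (∀ z ∈ ball (ctr t) (3 - θ - δ / 2), 2 < z.re → L z = log (riemannZeta z)) ∧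
      ∀ z ∈ closedBall (ctr t) (3 - θ - δ), ‖L z‖ ≤ A₃ / δ * Real.log |t| := by
  set R : ℝ := 3 - θ - δ / 2 with hRdef
  set r : ℝ := 3 - θ - δ with hrdef
  have hR₀ : 0 < R := by rw [hRdef]; linarith
  set c : ℂ := ctr t with hc
  have hsub : ball c R ⊆ ball c (InvZetaRH.R₀ δ) := ball_subset_ball_RH hθ
  have hf : DifferentiableOn ℂ riemannZeta (ball c R) :=
    (differentiableOn_riemannZeta_ball hδ ht).mono hsub
  have hf0 : ∀ z ∈ ball c R, riemannZeta z ≠ 0 := fun z hz =>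
    riemannZeta_ne_zero_of_mem_ball hQ hδ hz
  obtain ⟨L, hLd, hLc, hLder, hexp⟩ := exists_log_of_ball hR₀ hf hf0
  -- agreement with the principal logarithm on `V = disc ∩ {Re z > 2}`
  have hV : ∀ z ∈ ball c R, 2 < z.re → L z = log (riemannZeta z) := by
    set V : Set ℂ := ball c R ∩ {z : ℂ | 2 < z.re} with hVdef
    have hVo : IsOpen V := isOpen_ball.inter (isOpen_lt continuous_const continuous_re)
    have hVc : IsPreconnected V :=
      ((convex_ball _ _).inter (convex_halfSpace_re_gt 2)).isPreconnected
    have hcV : c ∈ V :=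
      ⟨mem_ball_self hR₀, by simp only [Set.mem_setOf_eq, hc, ctr_re]; norm_num⟩
    have hne1 : ∀ z ∈ V, z ≠ 1 := by
      rintro z ⟨-, hz⟩ rfl
      norm_num at hz
    have hLV : DifferentiableOn ℂ L V := hLd.mono inter_subset_left
    have hlogV : DifferentiableOn ℂ (fun z => log (riemannZeta z)) V := by
      intro z hz
      exact ((differentiableAt_riemannZeta (hne1 z hz)).clog
        (riemannZeta_mem_slitPlane (le_of_lt hz.2))).differentiableWithinAt
    have hder : V.EqOn (deriv L) (deriv fun z => log (riemannZeta z)) := by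
      intro z hz
      rw [(hLder z hz.1).deriv, ((differentiableAt_riemannZeta (hne1 z hz)).hasDerivAt.clog
        (riemannZeta_mem_slitPlane (le_of_lt hz.2))).deriv]
    have heq := hVo.eqOn_of_deriv_eq hVc hLV hlogV hder hcV hLc
    intro z hz hz2
    exact heq ⟨hz, hz2⟩
  refine ⟨L, hLd, hexp, hV, ?_⟩
  -- Borel–Carathéodory on the disc, translated to the origin
  intro z hz
  have hlog1 : 1 ≤ Real.log |t| := one_le_log_abs ht
  set M : ℝ := 2 * Real.log |t| with hM
  have hM0 : 0 < M := by rw [hM]; linarith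
  set f₀ : ℂ → ℂ := fun w => L (c + w) with hf₀
  have hshift : ∀ w ∈ ball (0 : ℂ) R, c + w ∈ ball c R := by
    intro w hw
    rw [mem_ball_zero_iff] at hw
    rwa [mem_ball, dist_eq_norm, add_sub_cancel_left]
  have hf₀d : DifferentiableOn ℂ f₀ (ball 0 R) := by
    intro w hw
    exact ((hLd.differentiableAt (isOpen_ball.mem_nhds (hshift w hw))).comp w
      ((differentiableAt_const c).add differentiableAt_id)).differentiableWithinAt
  have hmaps : MapsTo f₀ (ball 0 R) {w | w.re ≤ M} := by
    intro w hw
    have hcw := hshift w hw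
    show (L (c + w)).re ≤ M
    have hre : (L (c + w)).re = Real.log ‖riemannZeta (c + w)‖ := by
      rw [← hexp _ hcw, norm_exp, Real.log_exp]
    rw [hre]
    have hζpos : 0 < ‖riemannZeta (c + w)‖ := norm_pos_iff.mpr (hf0 _ hcw)
    calc Real.log ‖riemannZeta (c + w)‖ ≤ Real.log (|t| ^ 2) :=
          Real.log_le_log hζpos (norm_riemannZeta_le_sq hδ ht (hsub hcw))
      _ = M := by rw [Real.log_pow, hM]; norm_num
  have hzc : ‖z - c‖ ≤ r := by rwa [mem_closedBall, dist_eq_norm] at hz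
  have hr₃R : r < R := by rw [hrdef, hRdef]; linarith
  have hw : z - c ∈ ball (0 : ℂ) R := by
    rw [mem_ball_zero_iff]; exact hzc.trans_lt hr₃R
  have key := borelCaratheodory hM0 hf₀d hmaps hR₀ hw
  have hf₀z : f₀ (z - c) = L z := by simp [hf₀]
  have hf₀0 : f₀ 0 = log (riemannZeta c) := by simp only [hf₀, add_zero, hc]; exact hLc
  rw [hf₀z, hf₀0] at key
  -- numerical bounds
  have hden : δ / 2 ≤ R - ‖z - c‖ := by rw [hRdef]; rw [hrdef] at hzc; linarith
  have hδ2pos : 0 < δ / 2 := by linarith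
  have hBc : ‖log (riemannZeta c)‖ ≤ B₁ :=
    norm_log_riemannZeta_le (by rw [hc, ctr_re]; norm_num)
  have hB₁ := B₁_pos
  have hr₃0 : 0 ≤ r := by rw [hrdef]; linarith
  have hr₃5 : r ≤ 5 / 2 := by rw [hrdef]; linarith
  have hRr5 : R + r ≤ 5 := by rw [hrdef, hRdef]; linarith
  have h1 : 2 * M * ‖z - c‖ / (R - ‖z - c‖) ≤ 2 * M * r / (δ / 2) :=
    div_le_div₀ (by positivity) (by gcongr) hδ2pos hden
  have h2 : ‖log (riemannZeta c)‖ * (R + ‖z - c‖) / (R - ‖z - c‖) ≤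
      B₁ * (R + r) / (δ / 2) :=
    div_le_div₀ (by positivity) (by gcongr) hδ2pos hden
  have h3 : 2 * M * r / (δ / 2) + B₁ * (R + r) / (δ / 2) = (4 * M * r + 2 * B₁ * (R + r)) / δ := by
    field_simp
    ring
  have h4 : 4 * M * r + 2 * B₁ * (R + r) ≤ A₃ * Real.log |t| := by
    unfold A₃
    rw [hM]
    have e1 : 4 * (2 * Real.log |t|) * r ≤ 20 * Real.log |t| := by nlinarith
    have e2 : 2 * B₁ * (R + r) ≤ 10 * B₁ * Real.log |t| := by nlinarith
    nlinarith
  calc ‖L z‖ ≤ 2 * M * ‖z - c‖ / (R - ‖z - c‖) +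
        ‖log (riemannZeta c)‖ * (R + ‖z - c‖) / (R - ‖z - c‖) := key
    _ ≤ 2 * M * r / (δ / 2) + B₁ * (R + r) / (δ / 2) := add_le_add h1 h2
    _ = (4 * M * r + 2 * B₁ * (R + r)) / δ := h3
    _ ≤ (A₃ * Real.log |t|) / δ := div_le_div_of_nonneg_right h4 hδ.le
    _ = A₃ / δ * Real.log |t| := by ring

/-! ### The three-circles step -/

/-- The three-circles exponent `a₀(θ, δ) = log(6−2θ−4δ)/log(6−2θ−2δ)` is `< 1`
(`θ < 1`, `0 < δ ≤ 1/2`). [folklore] -/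
lemma a₀_lt_one (hθ1 : θ < 1) (hδ : 0 < δ) (hδ2 : δ ≤ 1 / 2) :
    Real.log (6 - 2 * θ - 4 * δ) / Real.log (6 - 2 * θ - 2 * δ) < 1 := by
  rw [div_lt_one (Real.log_pos (by linarith))]
  exact Real.log_lt_log (by linarith) (by linarith)

/-- The three-circles exponent `a₀(θ, δ)` is `≥ 0`. [folklore] -/
lemma a₀_nonneg (hθ1 : θ < 1) (hδ : 0 < δ) (hδ2 : δ ≤ 1 / 2) :
    0 ≤ Real.log (6 - 2 * θ - 4 * δ) / Real.log (6 - 2 * θ - 2 * δ) :=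
  div_nonneg (Real.log_nonneg (by linarith)) (Real.log_nonneg (by linarith))

/-- **Three-circles interpolation** (Titchmarsh §14.2, general `θ`): with `L` as in
`exists_log_riemannZeta`, circles centred `3 + it` through `5/2 + it` (`‖L‖ ≤ B₂` there,
principal branch), `σ + it`, and `θ + δ + it` (`‖L‖ ≤ A₃δ⁻¹ log|t|` by the Borel–Carathéodory
step) give, for `θ + 2δ ≤ σ ≤ 5/2`, `‖L(σ+it)‖ ≤ B₂ (A₃ δ⁻¹ log|t|)^{a₀(θ,δ)}` with
`a₀(θ,δ) = log(6−2θ−4δ)/log(6−2θ−2δ) < 1`.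
[cite: Titchmarsh1986, Thm 14.2 (proof, three-circles step)] -/
theorem norm_log_le_rpow (hθ1 : θ < 1) (hδ : 0 < δ) (hδ2 : δ ≤ 1 / 2) (ht : 7 ≤ |t|)
    {L : ℂ → ℂ} (hLd : DifferentiableOn ℂ L (ball (ctr t) (3 - θ - δ / 2)))
    (hV : ∀ z ∈ ball (ctr t) (3 - θ - δ / 2), 2 < z.re → L z = log (riemannZeta z))
    (hM₃ : ∀ z ∈ closedBall (ctr t) (3 - θ - δ), ‖L z‖ ≤ A₃ / δ * Real.log |t|)
    {σ : ℝ} (hσ₁ : θ + 2 * δ ≤ σ) (hσ₂ : σ ≤ 5 / 2) :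
    ‖L (σ + t * I)‖ ≤ B₂ * (A₃ / δ * Real.log |t|) ^
      (Real.log (6 - 2 * θ - 4 * δ) / Real.log (6 - 2 * θ - 2 * δ)) := by
  set a₀ : ℝ := Real.log (6 - 2 * θ - 4 * δ) / Real.log (6 - 2 * θ - 2 * δ) with ha₀def
  set c : ℂ := ctr t with hc
  set M₃ : ℝ := A₃ / δ * Real.log |t| with hM₃def
  have hlog1 : 1 ≤ Real.log |t| := one_le_log_abs ht
  have h40 := forty_le_A₃_div hδ hδ2
  have hM₃1 : 1 ≤ M₃ := by rw [hM₃def]; nlinarith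
  have h13 : (1 / 2 : ℝ) < 3 - θ - δ := by linarith
  have h3R : 3 - θ - δ < 3 - θ - δ / 2 := by linarith
  -- bounds on the two circles
  have hM₁ : ∀ z : ℂ, ‖z - c‖ = 1 / 2 → ‖L z‖ ≤ B₂ := by
    intro z hz
    have hzb : z ∈ ball c (3 - θ - δ / 2) := by
      rw [mem_ball, dist_eq_norm, hz]; linarith
    have hzre : 2 < z.re := by
      have h := abs_re_le_norm (z - c)
      rw [hz] at h
      simp only [sub_re, hc, ctr_re] at h
      have := le_abs_self (z.re - 3)
      have := neg_abs_le (z.re - 3)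
      linarith
    rw [hV z hzb hzre]
    exact (norm_log_riemannZeta_le hzre.le).trans (le_max_left _ _)
  have hM₃' : ∀ z : ℂ, ‖z - c‖ = 3 - θ - δ → ‖L z‖ ≤ M₃ := fun z hz =>
    hM₃ z (by rw [mem_closedBall, dist_eq_norm, hz])
  -- the point `σ + it`
  set z : ℂ := σ + t * I with hzdef
  have hzc : z - c = ((σ - 3 : ℝ) : ℂ) := by
    simp only [hzdef, hc, ctr]; push_cast; ring
  have hnorm : ‖z - c‖ = 3 - σ := by
    rw [hzc, Complex.norm_real, Real.norm_eq_abs, abs_of_nonpos (by linarith)]; ring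
  have hz₁ : 1 / 2 ≤ ‖z - c‖ := by rw [hnorm]; linarith
  have hz₃ : ‖z - c‖ ≤ 3 - θ - δ := by rw [hnorm]; linarith
  have key := norm_le_of_three_circles (by norm_num) h13 h3R hLd hM₁ hM₃' hz₁ hz₃
  -- the exponent
  set a : ℝ := Real.log (‖z - c‖ / (1 / 2)) / Real.log ((3 - θ - δ) / (1 / 2)) with hadef
  have hden : 0 < Real.log ((3 - θ - δ) / (1 / 2)) := Real.log_pos (by linarith)
  have ha0 : 0 ≤ a := div_nonneg (Real.log_nonneg (by rw [hnorm]; linarith)) hden.le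
  have ha1 : a ≤ a₀ := by
    rw [hadef, hnorm, ha₀def, show (3 - σ) / (1 / 2) = 6 - 2 * σ by ring,
      show (3 - θ - δ) / (1 / 2 : ℝ) = 6 - 2 * θ - 2 * δ by ring]
    exact div_le_div_of_nonneg_right (Real.log_le_log (by linarith) (by linarith))
      (Real.log_pos (by linarith)).le
  have ha1' : a ≤ 1 := ha1.trans (a₀_lt_one hθ1 hδ hδ2).le
  have hB₂ := one_le_B₂
  have e1 : B₂ ^ (1 - a) ≤ B₂ := by
    calc B₂ ^ (1 - a) ≤ B₂ ^ (1 : ℝ) := Real.rpow_le_rpow_of_exponent_le hB₂ (by linarith)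
      _ = B₂ := Real.rpow_one _
  have e2 : M₃ ^ a ≤ M₃ ^ a₀ := Real.rpow_le_rpow_of_exponent_le hM₃1 ha1
  calc ‖L z‖ ≤ B₂ ^ (1 - a) * M₃ ^ a := key
    _ ≤ B₂ * M₃ ^ a₀ := mul_le_mul e1 e2 (Real.rpow_nonneg (by linarith) _) (by linarith)

/-! ### The analogue of Titchmarsh (14.2.6) -/

/-- **`1/ζ(s) = O(t^ε)` for `σ > θ` under quasi-RH(`θ`)** (Littlewood 1912; Titchmarsh 1986,
Thm. 14.2, eq. (14.2.6), printed for `θ = 1/2`, proof verbatim for a zero-free half-plane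
`σ > θ`), uniformly in `σ ≥ σ₀ > θ`: if `ζ(s) ≠ 0` for `θ < Re s < 1` with `1/2 ≤ θ < 1`, then
for every `σ₀ > θ` and `ε > 0` there is `T` with `‖ζ(σ+it)⁻¹‖ ≤ |t|^ε` for all `σ ≥ σ₀`,
`|t| ≥ T`. Proof: with `δ = min((σ₀ − θ)/2, 1/2)`, the Borel–Carathéodory step and the
three-circles step give
`log|1/ζ(σ+it)| = −Re L ≤ ‖L(σ+it)‖ ≤ B₂ (A₃δ⁻¹ log|t|)^{a₀} ≤ ε log|t|` for `log|t|` large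
(as `a₀ < 1`) when `σ ≤ 5/2`; for `σ ≥ 5/2`, `‖1/ζ‖ ≤ (1 − ρ)⁻¹`.
[cite: Titchmarsh1986, Thm 14.2, eq. (14.2.6)] -/
theorem norm_inv_riemannZeta_le_rpow (hQ : QuasiRiemannHypothesis θ) (hθ : 1 / 2 ≤ θ)
    (hθ1 : θ < 1) {σ₀ : ℝ} (hσ₀ : θ < σ₀) {ε : ℝ} (hε : 0 < ε) :
    ∃ T : ℝ, ∀ σ t : ℝ, σ₀ ≤ σ → T ≤ |t| → ‖(riemannZeta (σ + t * I))⁻¹‖ ≤ |t| ^ ε := by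
  set δ : ℝ := min ((σ₀ - θ) / 2) (1 / 2) with hδdef
  have hδ : 0 < δ := lt_min (by linarith) (by norm_num)
  have hδ2 : δ ≤ 1 / 2 := min_le_right _ _
  have hσδ : θ + 2 * δ ≤ σ₀ := by
    have := min_le_left ((σ₀ - θ) / 2) (1 / 2)
    rw [← hδdef] at this
    linarith
  set K : ℝ := A₃ / δ with hK
  have hK40 : 40 ≤ K := forty_le_A₃_div hδ hδ2
  set a : ℝ := Real.log (6 - 2 * θ - 4 * δ) / Real.log (6 - 2 * θ - 2 * δ) with ha
  have ha1 : a < 1 := a₀_lt_one hθ1 hδ hδ2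
  have ha0 : 0 ≤ a := a₀_nonneg hθ1 hδ hδ2
  have hB₂ := one_le_B₂
  set Y : ℝ := (B₂ * K / ε) ^ (1 / (1 - a)) with hY
  have hY0 : 0 ≤ Y := Real.rpow_nonneg (by positivity) _
  have hρ := rho_lt_one
  set T : ℝ := max (max 7 (Real.exp Y)) (((1 - rho)⁻¹) ^ (1 / ε)) with hT
  refine ⟨T, fun σ t hσ ht => ?_⟩
  have ht7 : 7 ≤ |t| := le_trans (le_max_left _ _) (le_trans (le_max_left _ _) ht)
  have htY : Real.exp Y ≤ |t| := le_trans (le_max_right _ _) (le_trans (le_max_left _ _) ht)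
  have htρ : ((1 - rho)⁻¹) ^ (1 / ε) ≤ |t| := le_trans (le_max_right _ _) ht
  have htpos : 0 < |t| := by linarith
  have hlog1 : 1 ≤ Real.log |t| := one_le_log_abs ht7
  have hlogY : Y ≤ Real.log |t| := (Real.le_log_iff_exp_le htpos).mpr htY
  by_cases hσ5 : σ ≤ 5 / 2
  · obtain ⟨L, hLd, hexp, hV, hM₃⟩ := exists_log_riemannZeta hQ hθ hθ1 hδ hδ2 ht7
    set z : ℂ := σ + t * I with hzdef
    have hzball : z ∈ ball (ctr t) (3 - θ - δ / 2) := by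
      have hzc : z - ctr t = ((σ - 3 : ℝ) : ℂ) := by
        simp only [hzdef, ctr]; push_cast; ring
      rw [mem_ball, dist_eq_norm, hzc, Complex.norm_real, Real.norm_eq_abs,
        abs_of_nonpos (by linarith)]
      linarith
    have hLz : ‖L z‖ ≤ B₂ * (K * Real.log |t|) ^ a :=
      norm_log_le_rpow hθ1 hδ hδ2 ht7 hLd hV hM₃ (hσδ.trans hσ) hσ5
    -- `B₂ (K log|t|)^a ≤ ε log|t|`
    have hK1 : 1 ≤ K := by linarith
    have hKa : (K * Real.log |t|) ^ a ≤ K * Real.log |t| ^ a := by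
      rw [Real.mul_rpow (by linarith) (by linarith)]
      gcongr
      calc K ^ a ≤ K ^ (1 : ℝ) := Real.rpow_le_rpow_of_exponent_le hK1 ha1.le
        _ = K := Real.rpow_one K
    have hpow : B₂ * K / ε ≤ Real.log |t| ^ (1 - a) := by
      have h1 : Y ^ (1 - a) = B₂ * K / ε := by
        rw [hY, ← Real.rpow_mul (by positivity), one_div_mul_cancel (by linarith),
          Real.rpow_one]
      rw [← h1]
      exact Real.rpow_le_rpow hY0 hlogY (by linarith)
    have hsplit : Real.log |t| = Real.log |t| ^ a * Real.log |t| ^ (1 - a) := by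
      rw [← Real.rpow_add (by linarith)]; norm_num
    have hmain : B₂ * (K * Real.log |t| ^ a) ≤ ε * Real.log |t| := by
      have hla : 0 ≤ Real.log |t| ^ a := Real.rpow_nonneg (by linarith) _
      calc B₂ * (K * Real.log |t| ^ a) = (B₂ * K / ε) * ε * Real.log |t| ^ a := by
            field_simp
        _ ≤ Real.log |t| ^ (1 - a) * ε * Real.log |t| ^ a := by gcongr
        _ = ε * (Real.log |t| ^ a * Real.log |t| ^ (1 - a)) := by ring
        _ = ε * Real.log |t| := by rw [← hsplit]
    have hLz' : ‖L z‖ ≤ ε * Real.log |t| := by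
      calc ‖L z‖ ≤ B₂ * (K * Real.log |t|) ^ a := hLz
        _ ≤ B₂ * (K * Real.log |t| ^ a) := by gcongr
        _ ≤ ε * Real.log |t| := hmain
    -- `‖ζ(z)⁻¹‖ = exp(-Re L z) ≤ exp ‖L z‖ ≤ |t|^ε`
    have hinv : (riemannZeta z)⁻¹ = exp (-L z) := by rw [exp_neg, hexp z hzball]
    rw [hinv, norm_exp, Real.rpow_def_of_pos htpos]
    refine Real.exp_le_exp.mpr ?_
    have : -(L z).re ≤ ‖L z‖ := by
      have := abs_re_le_norm (L z)
      have := neg_abs_le (L z).re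
      linarith
    simp only [neg_re]
    nlinarith
  · -- `σ > 5/2`: `‖ζ⁻¹‖ ≤ (1 - ρ)⁻¹ ≤ |t|^ε`
    have hσ2 : 2 ≤ ((σ : ℂ) + t * I).re := by simp; linarith
    refine (norm_inv_riemannZeta_le_of_two_le hσ2).trans ?_
    have hbase : 0 ≤ (1 - rho)⁻¹ := inv_nonneg.mpr (by linarith)
    calc (1 - rho)⁻¹ = (((1 - rho)⁻¹) ^ (1 / ε)) ^ ε := by
          rw [← Real.rpow_mul hbase, one_div_mul_cancel hε.ne', Real.rpow_one]
      _ ≤ |t| ^ ε := Real.rpow_le_rpow (Real.rpow_nonneg hbase _) htρ hε.le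

end InvZetaQuasiRH

end Literature.NumberTheory.LFunctions

end
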